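import Summits.QuantumFields.BalabanUV.Beta.SymRootedMixedJetLinear
import Summits.QuantumFields.BalabanUV.Beta.SymRootedJetReflection
import Summits.QuantumFields.BalabanUV.Beta.RootedMixedJetReflectionLaw

/-!
# `BalabanUV.Beta.SymRootedMixedJetReflectionLaw` — THE TRANSVERSE AND LONGITUDINAL REFLECTION LAWS OF THE (0.4)-SYMMETRISED ROOTED MIXED
# JET `symMjetAt`, WITH THE REFLECTED BACKGROUND EXPANDED (β sub-cell, row D1, TABLES-SYM-LEAN S2c, INTERFACE-LEVEL twin «M2σ-mixed» of
# an3-g33's `RootedMixedJetReflectionLaw`; an1 gen 43)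

HONEST FRAMING (cell charter, verbatim): «discharging BetaPertH makes Bałaban's UV stability UNCONDITIONAL — a real
constructive-QFT result; it is NOT the continuum limit and NOT the Clay problem.»  HONEST DEPENDENCY (verbatim): «continuum YM on
T⁴ ⇐ BetaPertH ∧ nine spine estimates (0/9 proved); BetaPertH ⇐ (D1) ∧ (D4) ∧ CAP+tail; G-an2-4 gates asym, D1 and NE2/3/4.»
ABSOLUTE RULE (R-g25-7 ∕ R-D1-g30-1 (A)): the (0.4)-symmetrised averaging is the exp of the MEAN OF LOGS over the pair family
`{loop^{σ,σ′}}` with weight `((d!)²·L^d)⁻¹`; every object below is the comb module's algebra read on an1's `symPhiGAt` (S2b part 1)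
instead of `PhiGAt` — STATEMENT FOR STATEMENT under the dictionary `PhiXAt ↦ symPhiXAt`, `XjetAt ↦ symXjetAt`, `MσXAt ↦ symMσXAt`,
`L^{-d}·linAvgAt ↦ (d!·L^d)⁻¹·symLinU`, `L^{-d}·hessUAt ↦ ((d!)²L^d)⁻¹·symHessUAt`, `L^{-2d}·vhUAt ↦ ((d!)²L^{2d})⁻¹·symVhUAt`
(an3-g63 [AN3-G63-S2C] (C-ii): constants PER BCH ORDER; CONVENTION `(d!)²` un-normalised inside order-2 sym functionals).
FAMILY-INDEPENDENT chart ∕ letter ∕ `Tau`-algebra lemmas of the comb module are imported BY NAME, never re-proved.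
DERIVED cell leaf: [folklore] ring algebra; the `sym*` families are [our object]s.  No statement of Bałaban's papers is typed here, no
`[cite:]` tag, no `Prop` is minted, no binder of the β-function wall (`hW`/`hR`/`D1Tel`/`D1Rep`, (D1), `BetaPertH`) is instantiated or
discharged; nothing about the VALUES of `symMixFFAt`∕`symVh₂SAt` and no (T2-B)∕(T2-M₂) letter is discharged in this file.
NOT D1, NOT BetaPertH, NOT continuum, NOT Clay.  NOT summit progress.
Provenance: β sub-cell, TABLES-SYM-LEAN S2c option (C) (S2C-SCOPE-v1 94facb80ac685517), unit b2b-balaban-beta-an1-g43 (W-supplier AN1,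
FREEZE (0): scratch for a courier; an1 files nothing), 2026-08-21; no existing file touched.

## What this module proves (centred root `ctr d L`, `L` odd, `(2 : 𝕜) ≠ 0`; reflected axis `α`, `w, v, b̃ := R1g α W, R1g α V, R1g α B`)
* §1 `fst`∕`snd` bookkeeping of the symmetrised mixed averaging in `Rho 𝔸` (`fst_symPhiMLAt`, `fst_symPhiMAt`, `fst_symPhiMAt_zero_zero = 1`);
  the axis correction `DR` and the `Tau`-algebra lemmas are the comb module's, BY NAME.
* §2 TRANSVERSE LAW (`μ ≠ α`): `symMjetAt W V B L μ (sref α y) = symMjetAt w v b̃ L μ y + c11 (symMσGAt (Zf w v) (Zb w v) (DR α W V B) (Zf 0 0) (Zb 0 0) 0 L μ y)`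
  (`symMjetAt_sref_of_ne`), with its `Tau`-level form `symMσ_sref_of_ne`.
* §3 LONGITUDINAL LAW (`μ = α`, `y′ := bref α α y`): `symMσ_reflPair_self`, `symMjetAt_bref_self`.
* §4 the CONTACT EXPANSION `c11_symMσGAt_DR`.
-/

namespace Summit.QuantumFields.BalabanUV.Beta.SymRootedMixedJetReflectionLaw

open Literature.MathematicalPhysics.QuantumFieldTheory.Balaban1983to89
open Literature.MathematicalPhysics.QuantumFieldTheory.Balaban1983to89.Beta
open AffineAveraging (Form1)
open AveragingContoursRooted (ctr)
open AveragingThirdJet (Tau Rho dmk fst_dmk snd_dmk dfst_mul dsnd_mul upF upF_apply logT invT map_logT map_invT invT_one logT_one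
  ι_zero)
open AveragingThirdJet.Tau (τ₁ τ₂ τ12 ι c00 c10 c01 c11 mk ext4 c11_add c11_neg c11_τ₁_mul c11_τ₂_mul c11_τ12_mul τ₁_comm τ₂_comm
  τ12_comm)
open AveragingMixedJetTables (Zf Zb Gm Gmb)
open ResolventReflection (sref bref bref_of_ne bref_self)
open Summit.QuantumFields.BalabanUV.Beta.RootedHolonomyReflection (R1g R1g_of_ne)
open Summit.QuantumFields.BalabanUV.Beta.RootedHolonomyReflectionHol (reflPair reflPair_of_ne reflPair_self)
open Summit.QuantumFields.BalabanUV.Beta.TruncatedNil4Calculus (nil4_augR)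
open Summit.QuantumFields.BalabanUV.Beta.RootedMixedChartReflection (GmL GmbL fst_GmL snd_GmL fst_GmbL snd_GmbL BR BR_of_ne_R1g BR_self_R1g
  reflPair_Zf_Zb reflPair_Zb_Zf augR_Gm augR_Gmb Zb_mul_ι_mul_Zf)
open Summit.QuantumFields.BalabanUV.Beta.RootedMixedJetReflectionLaw (Zf_zero Zb_zero R1g_zero BR_zero_zero DR BR_eq_upF_add_DR DR_of_ne DR_self
  fst_logT fst_invT_of_fst_eq_one snd_invT_of_fst_eq_one snd_neg_invT_mul_mul D1R D2R D12R mk_sub_ι DR_eq)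
open Summit.QuantumFields.BalabanUV.Beta.SymAveragingMixedJetTables (symPhiGAt map_symPhiGAt symPhiGAt_one symPhiMAt symMjetAt)
open Summit.QuantumFields.BalabanUV.Beta.SymRootedJetDictionary (aug_symPhiGAt_eq_one)
open Summit.QuantumFields.BalabanUV.Beta.SymRootedMixedChartReflection (symPhiMLAt symMσLAt symMjetLAt symPhiMAt_eq_symPhiMLAt
  symMjetAt_eq_symMjetLAt symMjetLAt_eq_c11 symPhiMAt_sref_of_ne symPhiMLAt_reflPair_self_eq_invT)
open Summit.QuantumFields.BalabanUV.Beta.SymRootedMixedJetLinear (symMσGAt symMσLAt_eq_symMσGAt symMσGAt_eq_symMσLAt_add symMσGAt_add_zero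
  symMσGAt_mul_central_zero)
open Summit.QuantumFields.BalabanUV.Beta.RootedJetReflection (logT_invT_mul_invT_invT)

variable {𝕜 : Type*} [Field 𝕜] {d : ℕ} {𝔸 : Type*} [Ring 𝔸] [Algebra 𝕜 𝔸]

/-! ## §1 Letters at zero fluctuation, the axis correction `DR`, and `fst`∕`snd` bookkeeping in `Rho 𝔸` -/

/-- [folklore] The group part of the mixed left-chart averaging is the averaging of the fluctuation pair (independent of the background). -/
theorem fst_symPhiMLAt (ρ : Fin d → ℤ) (Z Zb' b : Form1 d (Tau 𝔸)) (L : ℕ) (μ : Fin d) (y : Fin d → ℤ) :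
    (symPhiMLAt 𝕜 ρ Z Zb' b L μ y).fst = symPhiGAt 𝕜 ρ Z Zb' L μ y := by
  have h := map_symPhiGAt (TrivSqZeroExt.fstHom 𝕜 (Tau 𝔸) (Tau 𝔸)) ρ (GmL Z b) (GmbL Zb' b) L μ y
  simp only [TrivSqZeroExt.fstHom_apply, fst_GmL, fst_GmbL] at h
  exact h

/-- [folklore] The group part of node 12b's mixed averaging is the averaging of `(Zf W V, Zb W V)`. -/
theorem fst_symPhiMAt (ρ : Fin d → ℤ) (W V B : Form1 d 𝔸) (L : ℕ) (μ : Fin d) (y : Fin d → ℤ) :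
    (symPhiMAt 𝕜 ρ W V B L μ y).fst = symPhiGAt 𝕜 ρ (Zf 𝕜 W V) (Zb 𝕜 W V) L μ y := by
  rw [symPhiMAt_eq_symPhiMLAt, fst_symPhiMLAt]

/-- [folklore] The pure-background mixed averaging has TRIVIAL group part. -/
theorem fst_symPhiMAt_zero_zero (ρ : Fin d → ℤ) (B : Form1 d 𝔸) (L : ℕ) (μ : Fin d) (y : Fin d → ℤ) :
    (symPhiMAt 𝕜 ρ 0 0 B L μ y).fst = 1 := by
  rw [fst_symPhiMAt, Zf_zero, Zb_zero, symPhiGAt_one]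

/-! ## §2 The transverse law `μ ≠ α` -/

section Transverse

variable {L : ℕ} (hL : Odd L) (h2 : (2 : 𝕜) ≠ 0)
include hL h2

/-- [folklore] `μ ≠ α`, RAW FORM: the σ-jet of the original data at the reflected coarse bond `(μ, sref α y)` IS the two-background σ-jet of
the reflected letters `(Zf w v, Zb w v; BR)` against the reference `(1, 1; upF b̃)` at `(μ, y)`. -/
theorem symMσ_sref_of_ne {α μ : Fin d} (h : μ ≠ α) (W V B : Form1 d 𝔸) (y : Fin d → ℤ) :
    (logT 𝕜 (symPhiMAt 𝕜 (ctr d L) W V B L μ (sref α y) * invT (symPhiMAt 𝕜 (ctr d L) 0 0 B L μ (sref α y)))).snd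
      = symMσGAt 𝕜 (ctr d L) (Zf 𝕜 (R1g α W) (R1g α V)) (Zb 𝕜 (R1g α W) (R1g α V)) (BR (𝕜 := 𝕜) α W V B)
          (Zf 𝕜 0 0) (Zb 𝕜 0 0) (upF (R1g α B)) L μ y := by
  rw [symPhiMAt_sref_of_ne hL h2 h, symPhiMAt_sref_of_ne hL h2 h, reflPair_Zf_Zb, reflPair_Zb_Zf, reflPair_Zf_Zb, reflPair_Zb_Zf,
    R1g_zero, BR_zero_zero, symMσGAt]

/-- [folklore] **`μ ≠ α`: THE TRANSVERSE REFLECTION LAW OF THE ROOTED MIXED σ-JET** — pulled-back jet PLUS the un-normalised σ-jet of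
the axis correction `DR` (33M1's reference shift). -/
theorem symMσ_sref_of_ne_eq_add {α μ : Fin d} (h : μ ≠ α) (W V B : Form1 d 𝔸) (y : Fin d → ℤ) :
    (logT 𝕜 (symPhiMAt 𝕜 (ctr d L) W V B L μ (sref α y) * invT (symPhiMAt 𝕜 (ctr d L) 0 0 B L μ (sref α y)))).snd
      = symMσLAt 𝕜 (ctr d L) (Zf 𝕜 (R1g α W) (R1g α V)) (Zb 𝕜 (R1g α W) (R1g α V)) (Zf 𝕜 0 0) (Zb 𝕜 0 0) (upF (R1g α B)) L μ y
        + symMσGAt 𝕜 (ctr d L) (Zf 𝕜 (R1g α W) (R1g α V)) (Zb 𝕜 (R1g α W) (R1g α V)) (DR (𝕜 := 𝕜) α W V B)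
            (Zf 𝕜 0 0) (Zb 𝕜 0 0) 0 L μ y := by
  rw [symMσ_sref_of_ne hL h2 h, BR_eq_upF_add_DR, symMσGAt_eq_symMσLAt_add]

/-- [folklore] **`μ ≠ α`: THE TRANSVERSE REFLECTION LAW OF NODE 12b's ROOTED MIXED JET `symMjetAt`.** -/
theorem symMjetAt_sref_of_ne {α μ : Fin d} (h : μ ≠ α) (W V B : Form1 d 𝔸) (y : Fin d → ℤ) :
    symMjetAt 𝕜 (ctr d L) W V B L μ (sref α y)
      = symMjetAt 𝕜 (ctr d L) (R1g α W) (R1g α V) (R1g α B) L μ y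
        + c11 (symMσGAt 𝕜 (ctr d L) (Zf 𝕜 (R1g α W) (R1g α V)) (Zb 𝕜 (R1g α W) (R1g α V)) (DR (𝕜 := 𝕜) α W V B)
            (Zf 𝕜 0 0) (Zb 𝕜 0 0) 0 L μ y) := by
  rw [symMjetAt, symMσ_sref_of_ne_eq_add hL h2 h, c11_add, symMjetAt_eq_symMjetLAt, symMjetLAt_eq_c11]

end Transverse

/-! ## §3 The longitudinal law `μ = α` -/

section Longitudinal

variable {L : ℕ} (hL : Odd L) (h2 : (2 : 𝕜) ≠ 0)
include hL h2

/-- [folklore] `μ = α`, RAW FORM: the two-background σ-jet of the reflected letters at `(α, y)` is MINUS the original σ-jet at the partner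
bond `(α, y′)`, `y′ = bref α α y`, MINUS THE COMMUTATOR of the pure-fluctuation logarithm `(logT Φ).fst` with the linear background average
`Φ₀.snd` (`Φ = symPhiMAt W V B L α y′`, `Φ₀ = symPhiMAt 0 0 B L α y′`; leaf-05's `symPhiMLAt_reflPair_self_eq_invT` twice + 33D's
`logT_invT_mul_invT_invT`; the reference has trivial group part, `fst_symPhiMAt_zero_zero`). -/
theorem symMσ_reflPair_self (α : Fin d) (W V B : Form1 d 𝔸) (y : Fin d → ℤ) :
    symMσGAt 𝕜 (ctr d L) (Zf 𝕜 (R1g α W) (R1g α V)) (Zb 𝕜 (R1g α W) (R1g α V)) (BR (𝕜 := 𝕜) α W V B)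
        (Zf 𝕜 0 0) (Zb 𝕜 0 0) (upF (R1g α B)) L α y
      = -((logT 𝕜 (symPhiMAt 𝕜 (ctr d L) W V B L α (bref α α y) * invT (symPhiMAt 𝕜 (ctr d L) 0 0 B L α (bref α α y)))).snd
          + ((logT 𝕜 (symPhiMAt 𝕜 (ctr d L) W V B L α (bref α α y))).fst * (symPhiMAt 𝕜 (ctr d L) 0 0 B L α (bref α α y)).snd
              - (symPhiMAt 𝕜 (ctr d L) 0 0 B L α (bref α α y)).snd * (logT 𝕜 (symPhiMAt 𝕜 (ctr d L) W V B L α (bref α α y))).fst)) := by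
  have hΦ : AveragingThirdJet.augR 𝕜 (symPhiMAt 𝕜 (ctr d L) W V B L α (bref α α y)) = 1 :=
    aug_symPhiGAt_eq_one (augR_Gm W V B) (augR_Gmb W V B) (ctr d L) L α _
  have hΦ₀ : AveragingThirdJet.augR 𝕜 (symPhiMAt 𝕜 (ctr d L) 0 0 B L α (bref α α y)) = 1 :=
    aug_symPhiGAt_eq_one (augR_Gm 0 0 B) (augR_Gmb 0 0 B) (ctr d L) L α _
  have h0 : (symPhiMAt 𝕜 (ctr d L) 0 0 B L α (bref α α y)).fst = 1 := fst_symPhiMAt_zero_zero _ B L α _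
  have hB := BR_zero_zero (𝕜 := 𝕜) α B
  rw [symMσGAt, ← reflPair_Zf_Zb, ← reflPair_Zb_Zf, ← hB, ← R1g_zero (R := 𝔸) α, ← reflPair_Zf_Zb, ← reflPair_Zb_Zf, R1g_zero,
    symPhiMLAt_reflPair_self_eq_invT hL h2, symPhiMLAt_reflPair_self_eq_invT hL h2,
    logT_invT_mul_invT_invT (nil4_augR (𝕜 := 𝕜)) h2 hΦ hΦ₀, snd_neg_invT_mul_mul h0, fst_logT, fst_logT, dfst_mul,
    fst_invT_of_fst_eq_one h0, mul_one]

/-- [folklore] **`μ = α`: THE LONGITUDINAL REFLECTION LAW OF NODE 12b's ROOTED MIXED JET `symMjetAt`** (original side solved): with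
`y′ = bref α α y`, `w, v, b̃ = R1g α W, R1g α V, R1g α B`,
`symMjetAt W V B L α y′ = −( symMjetAt w v b̃ L α y + c11 (symMσGAt (Zf w v) (Zb w v) DR (Zf 0 0) (Zb 0 0) 0 L α y) + c11 [ (logT Φ).fst, Φ₀.snd ] )`. -/
theorem symMjetAt_bref_self (α : Fin d) (W V B : Form1 d 𝔸) (y : Fin d → ℤ) :
    symMjetAt 𝕜 (ctr d L) W V B L α (bref α α y)
      = -(symMjetAt 𝕜 (ctr d L) (R1g α W) (R1g α V) (R1g α B) L α y
          + c11 (symMσGAt 𝕜 (ctr d L) (Zf 𝕜 (R1g α W) (R1g α V)) (Zb 𝕜 (R1g α W) (R1g α V)) (DR (𝕜 := 𝕜) α W V B)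
              (Zf 𝕜 0 0) (Zb 𝕜 0 0) 0 L α y)
          + c11 ((logT 𝕜 (symPhiMAt 𝕜 (ctr d L) W V B L α (bref α α y))).fst * (symPhiMAt 𝕜 (ctr d L) 0 0 B L α (bref α α y)).snd
              - (symPhiMAt 𝕜 (ctr d L) 0 0 B L α (bref α α y)).snd * (logT 𝕜 (symPhiMAt 𝕜 (ctr d L) W V B L α (bref α α y))).fst)) := by
  have h := symMσ_reflPair_self (𝕜 := 𝕜) hL h2 α W V B y
  rw [BR_eq_upF_add_DR, symMσGAt_eq_symMσLAt_add] at h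
  have hc := congrArg c11 h
  rw [c11_add, ← symMjetLAt_eq_c11, ← symMjetAt_eq_symMjetLAt, c11_neg, c11_add] at hc
  rw [symMjetAt, hc, neg_add, neg_neg, add_assoc, add_neg_cancel, add_zero]

end Longitudinal

/-! ## §4 The axis correction in components and the contact expansion -/

section Components

/-- [folklore] **THE CONTACT EXPANSION** of the correction jet:
`c11 (symMσGAt … DR … 0) = c01 (symMσGAt … (upF D1R) … 0) + c10 (symMσGAt … (upF D2R) … 0) + c00 (symMσGAt … (upF D12R) … 0)`. -/
theorem c11_symMσGAt_DR (ρ : Fin d → ℤ) (Z Zb' Z₀ Zb₀ : Form1 d (Tau 𝔸)) (α : Fin d) (W V B : Form1 d 𝔸) (L : ℕ) (μ : Fin d)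
    (y : Fin d → ℤ) :
    c11 (symMσGAt 𝕜 ρ Z Zb' (DR (𝕜 := 𝕜) α W V B) Z₀ Zb₀ 0 L μ y)
      = c01 (symMσGAt 𝕜 ρ Z Zb' (upF (D1R α W V B)) Z₀ Zb₀ 0 L μ y)
        + c10 (symMσGAt 𝕜 ρ Z Zb' (upF (D2R α W V B)) Z₀ Zb₀ 0 L μ y)
        + c00 (symMσGAt 𝕜 ρ Z Zb' (upF (D12R (𝕜 := 𝕜) α W V B)) Z₀ Zb₀ 0 L μ y) := by
  have e1 : (fun κ x => τ₁ * ι (D1R α W V B κ x)) = fun κ x => τ₁ * upF (D1R α W V B) κ x := rfl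
  have e2 : (fun κ x => τ₂ * ι (D2R α W V B κ x)) = fun κ x => τ₂ * upF (D2R α W V B) κ x := rfl
  have e3 : (fun κ x => τ12 * ι (D12R (𝕜 := 𝕜) α W V B κ x)) = fun κ x => τ12 * upF (D12R (𝕜 := 𝕜) α W V B) κ x := rfl
  rw [DR_eq, symMσGAt_add_zero, symMσGAt_add_zero, e1, e2, e3, symMσGAt_mul_central_zero τ₁ τ₁_comm, symMσGAt_mul_central_zero τ₂ τ₂_comm,
    symMσGAt_mul_central_zero τ12 τ12_comm, c11_add, c11_add, c11_τ₁_mul, c11_τ₂_mul, c11_τ12_mul]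

end Components

end Summit.QuantumFields.BalabanUV.Beta.SymRootedMixedJetReflectionLaw
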